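import Summits.AtomisticToContinuum.Crystallization.Theses.HullPeriodRank

/-!
# Route `HullPeriodRank`, item `PeriodicOfThreePeriods`: the rank-ladder dictionary is a theorem

**A Delone set of ℝ³ with three linearly independent two-sided periods is the point set of a
`PeriodicConfiguration 3`** (`periodicOfThreePeriods_proof`, closing the route decl
`HullPeriodRank.PeriodicOfThreePeriods`; decomp-a2c lens-3, support item stmt-AtomisticToContinuum-24147 — the
dictionary of the period-rank ladder, used by the deciding theorems of `HullPeriodRank`, `PeriodPrecisionLadder`,
`PeriodCoherenceLadder` and `PlanarOrderLadder`).

Proof.  Lattice = ℤ-span of the three periods (a full-rank ℤ-lattice: the periods are an ℝ-basis); the set of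
two-sided periods of `X` is an additive subgroup, so `X` is invariant under the whole lattice; motif = the points
of `X` in the fundamental parallelepiped `ZSpan.fundamentalDomain` (finite by uniform separation — a separated
set meets a bounded set in finitely many points — and non-empty by relative density via `ZSpan.fract`);
motif points are inequivalent modulo the lattice (`ZSpan.fract_eq_fract`); and `P.points = X` by
`z = fract z + floor z`.  [BaakeGrimm2013 §3.1 (crystallographic point sets); Mathlib `ZSpan`; folklore]
-/

noncomputable section

namespace Summit.AtomisticToContinuum.Crystallization.Theorems

namespace HullPeriodRankPeriodicOfThreePeriods

open Literature.MathematicalPhysics.StatisticalMechanics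
open Filter Topology Metric

/-- A uniformly separated set meets every bounded set in finitely many points (cover the bounded set by
finitely many balls of radius `δ/2`; each contains at most one point of the set). [folklore] -/
theorem finite_inter_of_separated {X K : Set (EuclideanSpace ℝ (Fin 3))} {δ : ℝ} (hδ : 0 < δ)
    (hsep : ∀ p ∈ X, ∀ q ∈ X, p ≠ q → δ ≤ dist p q) (hK : Bornology.IsBounded K) :
    (X ∩ K).Finite := by
  have htb : TotallyBounded K := hK.isCompact_closure.totallyBounded.subset subset_closure
  obtain ⟨T, hTfin, hcov⟩ := Metric.totallyBounded_iff.1 htb (δ / 2) (by positivity)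
  have hch : ∀ p ∈ X ∩ K, ∃ y ∈ T, dist p y < δ / 2 := by
    intro p hp
    have h := hcov hp.2
    simp only [Set.mem_iUnion, Metric.mem_ball] at h
    obtain ⟨y, hyT, hy⟩ := h
    exact ⟨y, hyT, hy⟩
  choose! f hfT hfd using hch
  refine Set.Finite.of_finite_image (f := f) (hTfin.subset ?_) ?_
  · rintro _ ⟨p, hp, rfl⟩
    exact hfT p hp
  · intro p hp q hq hpq
    by_contra hne
    have h1 := hsep p hp.1 q hq.1 hne
    have h2 : dist p q ≤ dist p (f p) + dist q (f p) := dist_triangle_right _ _ _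
    have h3 := hfd p hp
    have h4 := hfd q hq
    rw [← hpq] at h4
    linarith

/-- **`PeriodicOfThreePeriods` holds**: lattice = ℤ-span of the three periods, motif = the points of `X` in the
fundamental parallelepiped (finite by separation, non-empty by relative density, inequivalent mod the
lattice by `ZSpan.fract`), and `P.points = X` because `X` is invariant under the whole period lattice.
[BaakeGrimm2013 §3.1; folklore] -/
theorem periodicOfThreePeriods_proof :
    Summit.AtomisticToContinuum.Crystallization.Theses.HullPeriodRank.PeriodicOfThreePeriods := by
  classical
  rintro X ⟨⟨δ, hδ, hsep⟩, ⟨r, hr⟩⟩ ⟨v, hv, hper⟩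
  let B : Module.Basis (Fin 3) ℝ (EuclideanSpace ℝ (Fin 3)) :=
    basisOfLinearIndependentOfCardEqFinrank hv (by simp)
  have hB : ∀ j, B j = v j := fun j => by
    simp [B]
  let L : Submodule ℤ (EuclideanSpace ℝ (Fin 3)) := Submodule.span ℤ (Set.range B)
  let S : AddSubgroup (EuclideanSpace ℝ (Fin 3)) :=
    { carrier := {g | ∀ p ∈ X, p + g ∈ X ∧ p - g ∈ X}
      zero_mem' := by
        intro p hp
        simpa using hp
      add_mem' := by
        intro a c ha hc p hp
        refine ⟨?_, ?_⟩
        · have h := (hc (p + a) (ha p hp).1).1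
          rwa [add_assoc] at h
        · have h := (hc (p - a) (ha p hp).2).2
          rwa [sub_sub] at h
      neg_mem' := by
        intro a ha p hp
        refine ⟨?_, ?_⟩
        · simpa [← sub_eq_add_neg] using (ha p hp).2
        · simpa using (ha p hp).1 }
  have hLS : ∀ g ∈ L, ∀ p ∈ X, p + g ∈ X ∧ p - g ∈ X := by
    have hle : L ≤ S.toIntSubmodule := by
      rw [Submodule.span_le]
      rintro _ ⟨j, rfl⟩
      show ∀ p ∈ X, p + B j ∈ X ∧ p - B j ∈ X
      intro p hp
      rw [hB]
      exact hper j p hp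
    intro g hg
    exact hle hg
  have hfractX : ∀ p ∈ X, ZSpan.fract B p ∈ X := by
    intro p hp
    rw [ZSpan.fract_apply]
    exact (hLS _ (ZSpan.floor B p).2 p hp).2
  have hMfin : (X ∩ ZSpan.fundamentalDomain B).Finite :=
    finite_inter_of_separated hδ hsep (ZSpan.fundamentalDomain_isBounded B)
  obtain ⟨p₀, hp₀, -⟩ := hr 0
  have hMne : hMfin.toFinset.Nonempty := by
    refine ⟨ZSpan.fract B p₀, ?_⟩
    rw [Set.Finite.mem_toFinset]
    exact ⟨hfractX p₀ hp₀, ZSpan.fract_mem_fundamentalDomain B p₀⟩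
  refine ⟨{ lattice := L, discrete := inferInstance, isZLattice := inferInstance,
            motif := hMfin.toFinset, motif_nonempty := hMne, eq_of_sub_mem := ?_ }, ?_⟩
  · intro a ha c hc hac
    rw [Set.Finite.mem_toFinset] at ha hc
    have ha' : ZSpan.fract B a = a := ZSpan.fract_eq_self.2 ha.2
    have hc' : ZSpan.fract B c = c := ZSpan.fract_eq_self.2 hc.2
    have hL : -a + c ∈ Submodule.span ℤ (Set.range B) := by
      rw [neg_add_eq_sub, ← neg_sub]
      exact L.neg_mem hac
    have h := (ZSpan.fract_eq_fract B a c).2 hL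
    calc a = ZSpan.fract B a := ha'.symm
      _ = ZSpan.fract B c := h
      _ = c := hc'
  · ext z
    constructor
    · rintro ⟨y, hy, g, hg, rfl⟩
      exact (hLS g hg y ((Set.Finite.mem_toFinset hMfin).1 hy).1).1
    · intro hz
      refine ⟨ZSpan.fract B z, ?_, (ZSpan.floor B z : EuclideanSpace ℝ (Fin 3)), (ZSpan.floor B z).2, ?_⟩
      · exact (Set.Finite.mem_toFinset hMfin).2 ⟨hfractX z hz, ZSpan.fract_mem_fundamentalDomain B z⟩
      · rw [ZSpan.fract_apply, sub_add_cancel]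

end HullPeriodRankPeriodicOfThreePeriods

end Summit.AtomisticToContinuum.Crystallization.Theorems

end
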